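import Summits.CriticalPhenomena.PercolationContinuityZ3.Theorems.Transplant.SkelWindowSpans
import Summits.CriticalPhenomena.PercolationContinuityZ3.Theorems.Transplant.SkelPhiRectAt
import HarnessLib

/-!
# L3′ (part 1): VERTEX-SPAN windows at φ-LEVEL — the structure-free re-cut of `SkelWindowSpans` for the D″ generic layer
# (DPRIME-SCOPE §2 L3′, p3 addendum K (B″); source `SkelWindowSpans`, class (5): hypotheses `hlip`, `hstep`)

builds on p205010 (kernel theorem, internal audit signed; external expert review pending) — nothing in this file uses p205010.
Lane `prim-bschramm-*`, seat `prim-bschramm-p2` (gen 7); helper file (`--supports stmt-CriticalPhenomena-4575`).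

The source file `SkelWindowSpans` (p2, gen 3) is typed over `Φ : PlanarSkeletonConc G`; the D″ node (`SamePDropOfSkeletonSign/Neg`) needs the
same toolkit over a bare planar map `φ : V → Site 2` with the two structure fields it uses — (lip) and (ι) steps — as explicit hypotheses
`hlip : Skelφ.Lip G φ`, `hstep : Skelφ.Steps G φ` (addendum K.1).  Definitions (`Skelφ.stair`, `Skelφ.VWin`, `Skelφ.VStair`) take `G φ`
explicitly; the Φ-free span lemmas of the source (`PlanarSkeletonConc.mem_vspan_edgesIn_iff`, `mem_vspan_edgesIn_of_adj`,
`exists_adj_of_mem_vspan_edgesIn'`, `edgesIn_vspan_edgesIn`, `vspan_edgesIn_mono`, `disjoint_of_φ`) are IMPORTED, not re-declared (K2.5);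
the column fact `Skelφ.exists_mem_graphBall_φ_eq (hstep)` is p3-g7's (`SkelPhiRectAt`).  Proofs are the source's, verbatim up to the dictionary.
* `Skelφ.stair G φ w₀ P ρ` (staircase window; the φ-level twin of `PlanarSkeletonConc.stair`), `mem_stair`, `stair_subset_Win`;
* `Skelφ.VWin G φ w₀ P R := vspan (edgesIn G (Win G φ w₀ P R))`, `Skelφ.VStair`, membership / containment / monotonicity / disjointness,
  `sep_VWin_of_sepInf (hlip)`, the `RunGeom` property `exists_adj_of_mem_VWin/VStair`, `edgesIn_VWin`;
* the STEP device `mem_VWin_of_step (hstep)` and its corollaries, the seam device, `root_mem_VWin (hstep)`, `exists_mem_VWin_φ_eq (hstep)`;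
* bridges `PlanarSkeletonConc.stair/VWin/VStair_eq_skelφ` (`rfl`, regression value; `Win_eq_skelφ` is hp-8's, `SkelPhiWinLevels`).
[cite: KozmaNitzan2024, §4 pp. 25–27 ((29), E_{i+1})] [cite: GrimmettPercolation1999, §7.2]
-/

noncomputable section

open scoped Classical

namespace Summit.CriticalPhenomena.PercolationContinuityZ3.Theorems

namespace Transplant

namespace Skelφ

open Literature.Probability.Percolation Literature.Probability.LatticeModels SimpleGraph KNCells
open Literature.Barriers.CriticalPhenomena (graphBall graphBall_finite mem_graphBall_self graphBall_mono)
open PlanarSkeletonConc (mem_vspan_edgesIn_iff mem_vspan_edgesIn_of_adj exists_adj_of_mem_vspan_edgesIn' edgesIn_vspan_edgesIn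
  vspan_edgesIn_mono)

variable {V : Type} (G : SimpleGraph V) [G.LocallyFinite] (φ : V → Site 2)

/-! ## §1 The staircase window at φ-level -/

/-- **The STAIRCASE window** over the planar set `P` with fibre-depth profile `ρ`: `{g : φ g ∈ P, d_G(w₀, g) ≤ ρ (φ g)}` (φ-level twin of
`PlanarSkeletonConc.stair`). [this work] -/
def stair (w₀ : V) (P : Finset (Site 2)) (ρ : Site 2 → ℕ) : Finset V :=
  P.biUnion fun x => (graphBall_finite G w₀ (ρ x)).toFinset.filter fun g => φ g = x

variable {G φ} in
/-- Membership in a staircase window. [folklore] -/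
theorem mem_stair {w₀ : V} {P : Finset (Site 2)} {ρ : Site 2 → ℕ} {g : V} :
    g ∈ stair G φ w₀ P ρ ↔ φ g ∈ P ∧ g ∈ graphBall G w₀ (ρ (φ g)) := by
  simp only [stair, Finset.mem_biUnion, Finset.mem_filter, Set.Finite.mem_toFinset]
  constructor
  · rintro ⟨x, hx, hg, rfl⟩; exact ⟨hx, hg⟩
  · rintro ⟨hP, hg⟩; exact ⟨_, hP, hg, rfl⟩

variable {G φ} in
/-- A staircase window under a uniform profile bound lies in the flat window. [folklore] -/
theorem stair_subset_Win {w₀ : V} {P : Finset (Site 2)} {ρ : Site 2 → ℕ} {R : ℕ} (hρ : ∀ x ∈ P, ρ x ≤ R) :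
    stair G φ w₀ P ρ ⊆ Win G φ w₀ P R := by
  intro g hg
  rw [mem_stair] at hg
  rw [mem_Win]
  exact ⟨graphBall_mono G w₀ (hρ _ hg.1) hg.2, hg.1⟩

/-! ## §2 Vertex spans of windows and staircase windows -/

variable [DecidableEq V]

/-- **The vertex span of a window**: the vertices of the edges of `G` with both endpoints in `Win G φ w₀ P R` — the region of record over
the planar set `P` at fibre depth `R` (φ-level twin of `PlanarSkeletonConc.VWin`). [this work] -/
def VWin (w₀ : V) (P : Finset (Site 2)) (R : ℕ) : Finset V := vspan (edgesIn G (Win G φ w₀ P R))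

/-- **The vertex span of a staircase window** (profile `ρ`; φ-level twin of `PlanarSkeletonConc.VStair`). [this work] -/
def VStair (w₀ : V) (P : Finset (Site 2)) (ρ : Site 2 → ℕ) : Finset V := vspan (edgesIn G (stair G φ w₀ P ρ))

variable {G φ}

/-! ### Membership, containment, monotonicity -/

/-- `VWin ⊆ Win`. [folklore] -/
theorem VWin_subset_Win (w₀ : V) (P : Finset (Site 2)) (R : ℕ) : VWin G φ w₀ P R ⊆ Win G φ w₀ P R := vspan_edgesIn_subset _

/-- `VStair ⊆ stair`. [folklore] -/
theorem VStair_subset_stair (w₀ : V) (P : Finset (Site 2)) (ρ : Site 2 → ℕ) : VStair G φ w₀ P ρ ⊆ stair G φ w₀ P ρ :=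
  vspan_edgesIn_subset _

/-- The planar footprint of a vertex of `VWin P R` lies in `P`. [folklore] -/
theorem φ_mem_of_mem_VWin {w₀ : V} {P : Finset (Site 2)} {R : ℕ} {y : V} (hy : y ∈ VWin G φ w₀ P R) : φ y ∈ P :=
  ((mem_Win G φ).1 (VWin_subset_Win w₀ P R hy)).2

/-- A vertex of `VWin P R` has depth `≤ R`. [folklore] -/
theorem mem_graphBall_of_mem_VWin {w₀ : V} {P : Finset (Site 2)} {R : ℕ} {y : V} (hy : y ∈ VWin G φ w₀ P R) :
    y ∈ graphBall G w₀ R :=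
  ((mem_Win G φ).1 (VWin_subset_Win w₀ P R hy)).1

/-- The planar footprint of a vertex of `VStair P ρ` lies in `P`, its depth is `≤ ρ (φ y)`. [folklore] -/
theorem mem_of_mem_VStair {w₀ : V} {P : Finset (Site 2)} {ρ : Site 2 → ℕ} {y : V} (hy : y ∈ VStair G φ w₀ P ρ) :
    φ y ∈ P ∧ y ∈ graphBall G w₀ (ρ (φ y)) :=
  mem_stair.1 (VStair_subset_stair w₀ P ρ hy)

/-- `RunGeom` for window spans: every vertex of the span has a `G`-neighbour in the span. [folklore] -/
theorem exists_adj_of_mem_VWin {w₀ : V} {P : Finset (Site 2)} {R : ℕ} {y : V} (hy : y ∈ VWin G φ w₀ P R) :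
    ∃ z ∈ VWin G φ w₀ P R, G.Adj y z :=
  exists_adj_of_mem_vspan_edgesIn' hy

/-- `RunGeom` for staircase spans. [folklore] -/
theorem exists_adj_of_mem_VStair {w₀ : V} {P : Finset (Site 2)} {ρ : Site 2 → ℕ} {y : V} (hy : y ∈ VStair G φ w₀ P ρ) :
    ∃ z ∈ VStair G φ w₀ P ρ, G.Adj y z :=
  exists_adj_of_mem_vspan_edgesIn' hy

/-- The inside edges of a window span are those of the window (every law restricted to `edgesIn` is unchanged). [folklore] -/
theorem edgesIn_VWin (w₀ : V) (P : Finset (Site 2)) (R : ℕ) : edgesIn G (VWin G φ w₀ P R) = edgesIn G (Win G φ w₀ P R) :=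
  edgesIn_vspan_edgesIn _

/-- The inside edges of a staircase span are those of the staircase window. [folklore] -/
theorem edgesIn_VStair (w₀ : V) (P : Finset (Site 2)) (ρ : Site 2 → ℕ) :
    edgesIn G (VStair G φ w₀ P ρ) = edgesIn G (stair G φ w₀ P ρ) :=
  edgesIn_vspan_edgesIn _

/-- Window spans grow with the planar set and the depth. [folklore] -/
theorem VWin_mono {w₀ : V} {P P' : Finset (Site 2)} (hP : P ⊆ P') {R R' : ℕ} (hR : R ≤ R') :
    VWin G φ w₀ P R ⊆ VWin G φ w₀ P' R' :=
  vspan_edgesIn_mono (Win_mono G φ hP hR)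

/-- Staircase spans grow with the planar set and the profile. [folklore] -/
theorem VStair_mono {w₀ : V} {P P' : Finset (Site 2)} (hP : P ⊆ P') {ρ ρ' : Site 2 → ℕ} (hρ : ∀ t ∈ P, ρ t ≤ ρ' t) :
    VStair G φ w₀ P ρ ⊆ VStair G φ w₀ P' ρ' := by
  refine vspan_edgesIn_mono fun g hg => ?_
  rw [mem_stair] at hg ⊢
  exact ⟨hP hg.1, graphBall_mono G w₀ (hρ _ hg.1) hg.2⟩

/-- A staircase span under a uniform profile bound lies in the window span. [folklore] -/
theorem VStair_subset_VWin {w₀ : V} {P P' : Finset (Site 2)} (hP : P ⊆ P') {ρ : Site 2 → ℕ} {R : ℕ} (hρ : ∀ t ∈ P, ρ t ≤ R) :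
    VStair G φ w₀ P ρ ⊆ VWin G φ w₀ P' R := by
  refine vspan_edgesIn_mono fun g hg => ?_
  rw [mem_stair] at hg
  rw [mem_Win]
  exact ⟨graphBall_mono G w₀ (hρ _ hg.1) hg.2, hP hg.1⟩

/-! ### Disjointness and separation through the planar map -/

/-- Window spans over disjoint planar sets are disjoint. [folklore] -/
theorem disjoint_VWin {w₀ : V} {P P' : Finset (Site 2)} (h : Disjoint P P') (R R' : ℕ) :
    Disjoint (VWin G φ w₀ P R) (VWin G φ w₀ P' R') :=
  Finset.disjoint_left.2 fun _ ha ha' => Finset.disjoint_left.1 h (φ_mem_of_mem_VWin ha) (φ_mem_of_mem_VWin ha')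

/-- A staircase span and a window span over disjoint planar sets are disjoint. [folklore] -/
theorem disjoint_VStair_VWin {w₀ : V} {P P' : Finset (Site 2)} (h : Disjoint P P') (ρ : Site 2 → ℕ) (R' : ℕ) :
    Disjoint (VStair G φ w₀ P ρ) (VWin G φ w₀ P' R') :=
  Finset.disjoint_left.2 fun _ ha ha' => Finset.disjoint_left.1 h (mem_of_mem_VStair ha).1 (φ_mem_of_mem_VWin ha')

/-- **No-edge separation of window spans from planar ℓ^∞-gap separation** (`Skelφ.sep_of_sepInf`, from (lip) alone).
[cite: KozmaNitzan2024, §4 p. 26 ((29))] -/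
theorem sep_VWin_of_sepInf (hlip : Lip G φ) {w₀ : V} {P P' : Finset (Site 2)} (h : PlanarSkeleton.SepInf (↑P : Set (Site 2)) ↑P')
    (R R' : ℕ) : KNCells.Sep G (VWin G φ w₀ P R) (VWin G φ w₀ P' R') :=
  sep_of_sepInf hlip h (fun _ ha => φ_mem_of_mem_VWin ha) (fun _ hb => φ_mem_of_mem_VWin hb)

/-! ## §3 The step device -/

/-- **The +1-slack membership device**: under (ι) steps, a vertex `y` of depth `≤ n` with `n + 1 ≤ R`, footprint in `P`, and a planar unit
neighbour `φ y + σ e_i ∈ P`, lies in the span `VWin P R` (the edge to the step-neighbour over `φ y + σ e_i` is inside `Win P R`). [this work] -/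
theorem mem_VWin_of_step (hstep : Steps G φ) {w₀ : V} {P : Finset (Site 2)} {R n : ℕ} {y : V} (hy : y ∈ graphBall G w₀ n)
    (hn : n + 1 ≤ R) (hP : φ y ∈ P) {i : Fin 2} {σ : ℤˣ} (hP' : φ y + Pi.single i (σ : ℤ) ∈ P) : y ∈ VWin G φ w₀ P R := by
  obtain ⟨y', hadj, hφ⟩ := hstep y i σ
  refine (mem_vspan_edgesIn_of_adj ?_ ?_ hadj).1
  · exact (mem_Win G φ).2 ⟨graphBall_mono G w₀ (by omega) hy, hP⟩
  · exact (mem_Win G φ).2 ⟨graphBall_mono G w₀ hn (BoxProdZ2.mem_graphBall_succ_of_adj G hy hadj), hφ ▸ hP'⟩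

/-- The same with the depth read off a window span `VWin P₀ R₀`, `R₀ + 1 ≤ R`. [this work] -/
theorem mem_VWin_of_mem_VWin_of_step (hstep : Steps G φ) {w₀ : V} {P₀ P : Finset (Site 2)} {R₀ R : ℕ} {y : V}
    (hy : y ∈ VWin G φ w₀ P₀ R₀) (hR : R₀ + 1 ≤ R) (hP : φ y ∈ P) {i : Fin 2} {σ : ℤˣ} (hP' : φ y + Pi.single i (σ : ℤ) ∈ P) :
    y ∈ VWin G φ w₀ P R :=
  mem_VWin_of_step hstep (mem_graphBall_of_mem_VWin hy) hR hP hP'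

/-- The same with the depth read off a staircase span (profile value at the footprint `+ 1 ≤ R`). [this work] -/
theorem mem_VWin_of_mem_VStair_of_step (hstep : Steps G φ) {w₀ : V} {P₀ P : Finset (Site 2)} {ρ : Site 2 → ℕ} {R : ℕ} {y : V}
    (hy : y ∈ VStair G φ w₀ P₀ ρ) (hR : ρ (φ y) + 1 ≤ R) (hP : φ y ∈ P) {i : Fin 2} {σ : ℤˣ}
    (hP' : φ y + Pi.single i (σ : ℤ) ∈ P) : y ∈ VWin G φ w₀ P R :=
  mem_VWin_of_step hstep (mem_of_mem_VStair hy).2 hR hP hP'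

/-- **Seam device**: a vertex of a span all of whose inside edges have BOTH endpoints' footprints in `P₁` or both in `P₂`, with depths
within `R₁` resp. `R₂`, lies in `VWin P₁ R₁ ∪ VWin P₂ R₂` (no slack needed). [this work] -/
theorem mem_union_VWin_of_seam {w₀ : V} {X : Finset V} {P₁ P₂ : Finset (Site 2)} {R₁ R₂ : ℕ} {y : V}
    (hy : y ∈ vspan (edgesIn G X))
    (hseam : ∀ z ∈ X, y ∈ X → G.Adj y z →
      (y ∈ Win G φ w₀ P₁ R₁ ∧ z ∈ Win G φ w₀ P₁ R₁) ∨ (y ∈ Win G φ w₀ P₂ R₂ ∧ z ∈ Win G φ w₀ P₂ R₂)) :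
    y ∈ VWin G φ w₀ P₁ R₁ ∪ VWin G φ w₀ P₂ R₂ := by
  obtain ⟨hyX, z, hz, hadj⟩ := mem_vspan_edgesIn_iff.1 hy
  rcases hseam z hz hyX hadj with ⟨h1, h2⟩ | ⟨h1, h2⟩
  · exact Finset.mem_union_left _ (mem_vspan_edgesIn_of_adj h1 h2 hadj).1
  · exact Finset.mem_union_right _ (mem_vspan_edgesIn_of_adj h1 h2 hadj).1

/-- **The root lies in the span of its window** as soon as the window has depth `≥ 1` and contains a planar unit neighbour of `φ w₀`.
[folklore] -/
theorem root_mem_VWin (hstep : Steps G φ) {w₀ : V} {P : Finset (Site 2)} {R : ℕ} (hR : 1 ≤ R) (hP : φ w₀ ∈ P) {i : Fin 2} {σ : ℤˣ}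
    (hP' : φ w₀ + Pi.single i (σ : ℤ) ∈ P) : w₀ ∈ VWin G φ w₀ P R :=
  mem_VWin_of_step hstep (mem_graphBall_self G w₀ 0) (by omega) hP hP'

/-- **The column point**: under (ι) steps, the planar point `x ∈ P` is the footprint of a vertex of `VWin P R` once `R` exceeds the planar
ℓ¹-offset of `x` from `φ w₀` by one and `x` has a planar unit neighbour in `P` (p3-g7's `Skelφ.exists_mem_graphBall_φ_eq` + the step device).
[cite: KozmaNitzan2024, §4 p. 26 ((29): the column of x inside Q_x)] -/
theorem exists_mem_VWin_φ_eq (hstep : Steps G φ) {w₀ : V} {P : Finset (Site 2)} {x : Site 2} (hx : x ∈ P) {i : Fin 2} {σ : ℤˣ}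
    (hx' : x + Pi.single i (σ : ℤ) ∈ P) {R : ℕ} (hR : (x 0 - φ w₀ 0).natAbs + (x 1 - φ w₀ 1).natAbs + 1 ≤ R) :
    ∃ y ∈ VWin G φ w₀ P R, φ y = x := by
  obtain ⟨g, hg, hφ⟩ := exists_mem_graphBall_φ_eq hstep w₀ x
  refine ⟨g, mem_VWin_of_step hstep hg hR (by rw [hφ]; exact hx) (i := i) (σ := σ) ?_, hφ⟩
  rw [hφ]; exact hx'

end Skelφ

/-! ## §4 Bridges (regression value): the `PlanarSkeletonConc` objects of `SkelWindowSpans` are the φ-level ones, by `rfl` -/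

namespace PlanarSkeletonConc

open Literature.Probability.LatticeModels

variable {V : Type} {G : SimpleGraph V} [G.LocallyFinite] (Φ : PlanarSkeletonConc G)

/-- `PlanarSkeletonConc.stair` is the φ-level staircase window of `Φ.φ`. [folklore] -/
theorem stair_eq_skelφ (w₀ : V) (P : Finset (Site 2)) (ρ : Site 2 → ℕ) : Φ.stair w₀ P ρ = Skelφ.stair G Φ.φ w₀ P ρ := rfl

variable [DecidableEq V]

/-- `PlanarSkeletonConc.VWin` is the φ-level window span of `Φ.φ`. [folklore] -/
theorem VWin_eq_skelφ (w₀ : V) (P : Finset (Site 2)) (R : ℕ) : Φ.VWin w₀ P R = Skelφ.VWin G Φ.φ w₀ P R := rfl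

/-- `PlanarSkeletonConc.VStair` is the φ-level staircase span of `Φ.φ`. [folklore] -/
theorem VStair_eq_skelφ (w₀ : V) (P : Finset (Site 2)) (ρ : Site 2 → ℕ) : Φ.VStair w₀ P ρ = Skelφ.VStair G Φ.φ w₀ P ρ := rfl

end PlanarSkeletonConc

end Transplant

end Summit.CriticalPhenomena.PercolationContinuityZ3.Theorems

end
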